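import Summits.AtomisticToContinuum.HydrodynamicLimit.Theses.BallwiseInvariantReferences
import Summits.AtomisticToContinuum.HydrodynamicLimit.Theorems.AnnealedZeroHorizonMeanFluxClosureCollisionEnergyExchangeMeanBoundB
import Literature.Analysis.FluidPDE.CollisionPayload
import Literature.Analysis.FluidPDE.HardSphereCollisionRecord
import Literature.MathematicalPhysics.KineticTheory.SerrePeriodicPayloadProofs
import HarnessLib

/-!
# Route `MourreKoopmanCharges`, crux `LinearToEntropyInBand` (stmt-AtomisticToContinuum-17740), line `registered`:
# stub 3 `stub_fastCollisionThroughputInBand` — part A: `LanfordEnvelopeR ⟹ FastCollisionThroughput` (wave 2)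

Stub 3, `LTEInBand.FastCollisionThroughputInBand`, is the packing-guarded (weaker) form of the shared typed
crux `BallwiseInvariantReferences.FastCollisionThroughput` (stmt-AtomisticToContinuum-13022): under the TRUE
law `λ_N = localGibbsLaw σ a₀ u₀ θ₀ N (Φ N)`, `∀ t < T ∀ η > 0 ∃ K N₀ ∀ N ≥ N₀`,
`(N+1)^{-4/3} E[Σᵢ Σ_{collision times s ∈ (0,t]} 𝟙{K < max(‖vᵢ(s⁻)‖,‖vᵢ(s)‖)} (1 + ‖vᵢ(s)+vᵢ(s⁻)‖/2) ‖vᵢ(s) − vᵢ(s⁻)‖] ≤ η`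
(`vᵢ(s⁻)` = `Function.leftLim`).  Audit of `Theorems/` (2026-08-17): no landed theorem concludes the crux
or a copy, and its birth skeleton (stubs B/R/T of `Cruxes/FastCollisionThroughput/Lines/birth.lean`) has no
landed support; landed IS the analytic spine of a route through the Lanford envelope —
`CollisionRate.stub_marginalEnvelopeLG_of_lanfordEnvelopeR` (`Theses.BGEndpointRigidity.LanfordEnvelopeR`,
stmt-13677, OPEN ⟹ the marginal envelope (A) of crux `CollisionRate`, stmt-13481) and the NON-stationary
one-window / Campbell inequality for any velocity mark,
`CollisionEnergyExchangeMeanBound.lintegral_windowCollisionSum_le_of_pairEnvelope` (CIP 1994 App. 4.A).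
This file adds the missing elementary pieces (no definitions; the two weights are kept inline) and lands
the by-name glue `glue_fastCollisionThroughput_of_lanfordEnvelopeR` (registered glue stub of stmt-17740;
part B `…FastCollisionThroughputInBand` adds the guarded statement and the constant-profile sanity twin):
(1) PATHWISE BOOKKEEPING `ofReal_throughput_le_markSum` (contact-pair analogue of stub B of 13022): at a
collision time the left limit is `collidePair` of the colliding pair (`leftLim_eq_collidePair`), only the
two partners jump, energy conservation bounds all four speeds by `‖v‖ + ‖w‖` and either jump by `‖v − w‖`
(`norm_collidePair_vel_sub`), so both jump weights `W_K` are dominated by the collision-invariant FAST MARK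
`b_K(v, w) = 𝟙{K² < ‖v‖² + ‖w‖²} 2 (1 + ‖v‖ + ‖w‖) ‖v − w‖` of the post-collisional pair
(`jumpWeight_collidePair_le`); (2) GAUSSIAN FAST TAIL `tendsto_fastMarkFlux`:
`∫ ‖w − v‖ b_K dN(u,θ)^{⊗2} → 0` (dominated convergence, landed Gaussian moments); (3) NORMALISATION
`rpow_mul_windowConst`: `(N+1)^{-4/3} · x (N+1)² ε_N² = x σ²`; (4) MEAN FORM
`lintegral_throughput_le_of_pairEnvelope` for ANY law carried by the good set with a pair envelope on
`[0, τ]`: throughput `≤ 4 C τ σ² · ∫ ‖w − v‖ b_K dγ dγ`; (5) the crux BODY at a fixed profile from the pair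
conjunct of (A), `fastCollisionThroughputAt_of_pairEnvelope` (level `K` from (2) against the
`N`-independent constant `4 C (t+1) σ²`; Euler solution and initial convergence unused), and the glue.

References: C. Cercignani, R. Illner, M. Pulvirenti, *The Mathematical Theory of Dilute Gases* (1994),
§4.2, App. 4.A; I. Gallagher, L. Saint-Raymond, B. Texier, *From Newton to Boltzmann* (2013), (1.1.2)–(1.1.3),
Ch. 4–6; H. Spohn, *Large Scale Dynamics of Interacting Particles* (1991), Part I §2.3, §3.3.
-/

noncomputable section

open MeasureTheory Filter Set Topology
open scoped ENNReal InnerProductSpace BigOperators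

namespace Summit.AtomisticToContinuum.HydrodynamicLimit.Theorems.LTEInBand

open Literature.Analysis.FluidPDE Literature.MathematicalPhysics.KineticTheory
open Summit.AtomisticToContinuum.HydrodynamicLimit.Theses

/-! Two explicit weights recur below (kept inline, no definitions): the crux's PER-PARTICLE JUMP WEIGHT
`W_K(a⁻, a) = 𝟙{K < max(‖a⁻‖, ‖a‖)} (1 + ‖a + a⁻‖/2) ‖a − a⁻‖` of a (pre-, post-)collisional velocity pair
`(a⁻, a)` of one particle, and the FAST MARK of an ordered pair of velocities `(v, w)` at level `K`,
`b_K(v, w) = 𝟙{K² < ‖v‖² + ‖w‖²} · 2 (1 + ‖v‖ + ‖w‖) ‖v − w‖` — a collision invariant dominating the jump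
weights of both partners of a binary collision with (pre- or post-collisional) velocities `(v, w)`. -/

/-- The jump weight `W_K(a⁻, a)` is non-negative. -/
theorem jumpWeight_nonneg (K : ℝ) (a' a : V3) :
    0 ≤ (if K < max ‖a'‖ ‖a‖ then (1 + ‖a + a'‖ / 2) * ‖a - a'‖ else 0) := by
  split_ifs <;> positivity

/-- The fast mark is dominated by the level-free weight `2 (1 + ‖v‖ + ‖w‖) ‖v − w‖`. -/
theorem fastMark_le (K : ℝ) (p : V3 × V3) :
    (if K ^ 2 < ‖p.1‖ ^ 2 + ‖p.2‖ ^ 2 then 2 * ((1 + ‖p.1‖ + ‖p.2‖) * ‖p.1 - p.2‖) else 0) ≤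
      2 * ((1 + ‖p.1‖ + ‖p.2‖) * ‖p.1 - p.2‖) := by
  split_ifs
  · exact le_rfl
  · positivity

/-- The fast mark vanishes on pairs of energy at most `K²`. -/
theorem fastMark_eq_zero_of_le {K : ℝ} {p : V3 × V3} (h : ‖p.1‖ ^ 2 + ‖p.2‖ ^ 2 ≤ K ^ 2) :
    (if K ^ 2 < ‖p.1‖ ^ 2 + ‖p.2‖ ^ 2 then 2 * ((1 + ‖p.1‖ + ‖p.2‖) * ‖p.1 - p.2‖) else 0) = 0 := by
  rw [if_neg (not_lt.2 h)]

/-- The fast mark is measurable. -/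
theorem measurable_fastMark (K : ℝ) :
    Measurable (fun p : V3 × V3 =>
      (if K ^ 2 < ‖p.1‖ ^ 2 + ‖p.2‖ ^ 2 then 2 * ((1 + ‖p.1‖ + ‖p.2‖) * ‖p.1 - p.2‖) else 0)) := by
  refine Measurable.ite (measurableSet_lt measurable_const ?_) ?_ measurable_const
  · fun_prop
  · fun_prop

/-- **One-particle kinematics.** If the pre- and post-collisional speeds of a particle are controlled by
the pair energy `E ≤ B²` and its velocity jump by `R`, then its crux weight at level `K ≥ 0` is at most
`𝟙{K² < E} (1 + B) R`. -/
theorem jumpWeight_le {K E B R : ℝ} (hK : 0 ≤ K) (hB : 0 ≤ B) {a' a : V3}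
    (ha' : ‖a'‖ ^ 2 ≤ E) (ha : ‖a‖ ^ 2 ≤ E) (hE : E ≤ B ^ 2) (hj : ‖a - a'‖ ≤ R) :
    (if K < max ‖a'‖ ‖a‖ then (1 + ‖a + a'‖ / 2) * ‖a - a'‖ else 0) ≤
      if K ^ 2 < E then (1 + B) * R else 0 := by
  have ha'B : ‖a'‖ ≤ B := (abs_le_of_sq_le_sq' (ha'.trans hE) hB).2
  have haB : ‖a‖ ≤ B := (abs_le_of_sq_le_sq' (ha.trans hE) hB).2
  split_ifs with h1 h2
  · have h3 : ‖a + a'‖ ≤ ‖a‖ + ‖a'‖ := norm_add_le _ _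
    have h4 : 1 + ‖a + a'‖ / 2 ≤ 1 + B := by linarith
    have hR : 0 ≤ R := (norm_nonneg _).trans hj
    exact mul_le_mul h4 hj (norm_nonneg _) (by linarith)
  · exfalso
    refine h2 ?_
    rcases lt_max_iff.1 h1 with h | h
    · have : K ^ 2 < ‖a'‖ ^ 2 := by nlinarith [norm_nonneg a']
      exact this.trans_le ha'
    · have : K ^ 2 < ‖a‖ ^ 2 := by nlinarith [norm_nonneg a]
      exact this.trans_le ha
  · have hR : 0 ≤ R := (norm_nonneg _).trans hj
    positivity
  · exact le_rfl

/-- **One-collision kinematics.** In the elastic collision of the ordered pair `(p, q)` of a configuration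
`z` (post-collisional velocities `(v, w) = (v_p, v_q)`, pre-collisional ones read off `collidePair`), the
crux weights of the two partners together are at most the fast mark of `(v, w)`: energy conservation
bounds all four speeds by `√(‖v‖² + ‖w‖²) ≤ ‖v‖ + ‖w‖`, and either velocity jump is the normal
component of `v − w`. -/
theorem jumpWeight_collidePair_le {n : ℕ} (G : Geometry (Fin 3) T3) {p q : Fin n} (hpq : p ≠ q)
    (z : Config n (Fin 3) T3) {K : ℝ} (hK : 0 ≤ K) :
    (if K < max ‖(collidePair G p q z p).2‖ ‖(z p).2‖ then (1 + ‖(z p).2 + (collidePair G p q z p).2‖ / 2) * ‖(z p).2 - (collidePair G p q z p).2‖ else 0) +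
        (if K < max ‖(collidePair G p q z q).2‖ ‖(z q).2‖ then (1 + ‖(z q).2 + (collidePair G p q z q).2‖ / 2) * ‖(z q).2 - (collidePair G p q z q).2‖ else 0) ≤
      (if K ^ 2 < ‖(z p).2‖ ^ 2 + ‖(z q).2‖ ^ 2 then 2 * ((1 + ‖(z p).2‖ + ‖(z q).2‖) * ‖(z p).2 - (z q).2‖) else 0) := by
  set v : V3 := (z p).2 with hv
  set w : V3 := (z q).2 with hw
  have hE : ‖(collidePair G p q z p).2‖ ^ 2 + ‖(collidePair G p q z q).2‖ ^ 2 = ‖v‖ ^ 2 + ‖w‖ ^ 2 := by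
    rw [collidePair_apply_left hpq, collidePair_apply_right]
    exact norm_sq_reflectVel_fst_add_norm_sq_reflectVel_snd _ _
  have hj1 : ‖(collidePair G p q z p).2 - v‖ ≤ ‖v - w‖ := by
    rw [hv, hw, norm_collidePair_vel_sub hpq]
    exact abs_inner_div_norm_le_norm _ _
  have hj2 : ‖(collidePair G p q z q).2 - w‖ ≤ ‖v - w‖ := by
    rw [hw, collidePair_vel_sub_right_eq_neg hpq, norm_neg]
    exact hj1
  have hB : (0 : ℝ) ≤ ‖v‖ + ‖w‖ := by positivity
  have hEB : ‖v‖ ^ 2 + ‖w‖ ^ 2 ≤ (‖v‖ + ‖w‖) ^ 2 := by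
    nlinarith [norm_nonneg v, norm_nonneg w]
  have ha1 : ‖(collidePair G p q z p).2‖ ^ 2 ≤ ‖v‖ ^ 2 + ‖w‖ ^ 2 :=
    hE ▸ le_add_of_nonneg_right (sq_nonneg _)
  have ha2 : ‖(collidePair G p q z q).2‖ ^ 2 ≤ ‖v‖ ^ 2 + ‖w‖ ^ 2 :=
    hE ▸ le_add_of_nonneg_left (sq_nonneg _)
  have hv2 : ‖v‖ ^ 2 ≤ ‖v‖ ^ 2 + ‖w‖ ^ 2 := le_add_of_nonneg_right (sq_nonneg _)
  have hw2 : ‖w‖ ^ 2 ≤ ‖v‖ ^ 2 + ‖w‖ ^ 2 := le_add_of_nonneg_left (sq_nonneg _)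
  have hj1' : ‖v - (collidePair G p q z p).2‖ ≤ ‖v - w‖ := by rw [norm_sub_rev]; exact hj1
  have hj2' : ‖w - (collidePair G p q z q).2‖ ≤ ‖v - w‖ := by rw [norm_sub_rev]; exact hj2
  have h1 := jumpWeight_le (E := ‖v‖ ^ 2 + ‖w‖ ^ 2) (R := ‖v - w‖) hK hB ha1 hv2 hEB hj1'
  have h2 := jumpWeight_le (E := ‖v‖ ^ 2 + ‖w‖ ^ 2) (R := ‖v - w‖) hK hB ha2 hw2 hEB hj2'
  calc _ ≤ (if K ^ 2 < ‖v‖ ^ 2 + ‖w‖ ^ 2 then (1 + (‖v‖ + ‖w‖)) * ‖v - w‖ else 0) +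
        (if K ^ 2 < ‖v‖ ^ 2 + ‖w‖ ^ 2 then (1 + (‖v‖ + ‖w‖)) * ‖v - w‖ else 0) := add_le_add h1 h2
    _ = (if K ^ 2 < ‖v‖ ^ 2 + ‖w‖ ^ 2 then 2 * ((1 + ‖v‖ + ‖w‖) * ‖v - w‖) else 0) := by
        split_ifs <;> ring

open Summit.AtomisticToContinuum.HydrodynamicLimit.Theorems.RestartPrinciple.AgeDuhamelForgetting in
/-- **The fast tail of the Gaussian collision flux vanishes**: the Gaussian collision-flux integral of the
fast mark, `∫ ‖w − v‖ · b_n(v, w) dN(u,θ)(v) dN(u,θ)(w)`, tends to `0` as the level `n → ∞` (dominated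
convergence: the mark vanishes once `n² ≥ ‖v‖² + ‖w‖²`, and is dominated by `2 ‖v − w‖ (1 + ‖v‖ + ‖w‖)`,
whose flux integral is finite by the Gaussian second and third moments). -/
theorem tendsto_fastMarkFlux (u : V3) {θ : ℝ} (hθ : 0 < θ) :
    Tendsto (fun n : ℕ => ∫⁻ p, ENNReal.ofReal ‖p.2 - p.1‖ *
      ENNReal.ofReal (if (n : ℝ) ^ 2 < ‖p.1‖ ^ 2 + ‖p.2‖ ^ 2 then 2 * ((1 + ‖p.1‖ + ‖p.2‖) * ‖p.1 - p.2‖) else 0)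
        ∂((gaussMeasure u θ).prod (gaussMeasure u θ))) atTop (𝓝 0) := by
  set μ : Measure (V3 × V3) := (gaussMeasure u θ).prod (gaussMeasure u θ) with hμ
  set T1 : V3 × V3 → ℝ≥0∞ := fun p => ENNReal.ofReal ‖p.2 - p.1‖ * ENNReal.ofReal ‖p.1 - p.2‖ with hT1
  set T2 : V3 × V3 → ℝ≥0∞ := fun p =>
    ENNReal.ofReal ‖p.2 - p.1‖ * ENNReal.ofReal (‖p.1 - p.2‖ * (‖p.1‖ + ‖p.2‖)) with hT2
  set bound : V3 × V3 → ℝ≥0∞ := fun p => 2 * T1 p + 2 * T2 p with hbound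
  have hT1m : Measurable T1 := by rw [hT1]; fun_prop
  have hT2m : Measurable T2 := by rw [hT2]; fun_prop
  have hfin : ∫⁻ p, bound p ∂μ ≠ ∞ := by
    have h1 := mmr_lintegral_norm_sub_sq_prod_gaussMeasure_le u hθ
    have h2 := mmr_lintegral_energyMark_prod_gaussMeasure_le u hθ
    have heq : ∫⁻ p, bound p ∂μ = 2 * ∫⁻ p, T1 p ∂μ + 2 * ∫⁻ p, T2 p ∂μ := by
      rw [hbound, lintegral_add_left (hT1m.const_mul _), lintegral_const_mul _ hT1m,
        lintegral_const_mul _ hT2m]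
    rw [heq]
    exact ENNReal.add_ne_top.2 ⟨ENNReal.mul_ne_top ENNReal.ofNat_ne_top (ne_top_of_le_ne_top ENNReal.ofReal_ne_top h1),
      ENNReal.mul_ne_top ENNReal.ofNat_ne_top (ne_top_of_le_ne_top ENNReal.ofReal_ne_top h2)⟩
  have hpt : ∀ (n : ℕ) (p : V3 × V3),
      ENNReal.ofReal ‖p.2 - p.1‖ *
        ENNReal.ofReal (if (n : ℝ) ^ 2 < ‖p.1‖ ^ 2 + ‖p.2‖ ^ 2 then 2 * ((1 + ‖p.1‖ + ‖p.2‖) * ‖p.1 - p.2‖) else 0) ≤ bound p := by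
    intro n p
    refine (mul_le_mul' le_rfl (ENNReal.ofReal_le_ofReal (fastMark_le n p))).trans_eq ?_
    have hsplit : 2 * ((1 + ‖p.1‖ + ‖p.2‖) * ‖p.1 - p.2‖) =
        2 * ‖p.1 - p.2‖ + 2 * (‖p.1 - p.2‖ * (‖p.1‖ + ‖p.2‖)) := by ring
    rw [hsplit, ENNReal.ofReal_add (by positivity) (by positivity), ENNReal.ofReal_mul zero_le_two,
      ENNReal.ofReal_mul zero_le_two, ENNReal.ofReal_ofNat, hbound, hT1, hT2]
    ring
  have h := tendsto_lintegral_of_dominated_convergence (μ := μ)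
    (F := fun (n : ℕ) (p : V3 × V3) => ENNReal.ofReal ‖p.2 - p.1‖ *
      ENNReal.ofReal (if (n : ℝ) ^ 2 < ‖p.1‖ ^ 2 + ‖p.2‖ ^ 2 then 2 * ((1 + ‖p.1‖ + ‖p.2‖) * ‖p.1 - p.2‖) else 0))
    (f := fun _ => 0) bound
    (fun n => ((measurable_snd.sub measurable_fst).norm.ennreal_ofReal).mul
      (measurable_fastMark n).ennreal_ofReal)
    (fun n => ae_of_all _ (hpt n)) hfin
    (ae_of_all _ fun p => by
      obtain ⟨n₀, hn₀⟩ := exists_nat_ge (‖p.1‖ ^ 2 + ‖p.2‖ ^ 2 + 1)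
      refine (tendsto_const_nhds (x := (0 : ℝ≥0∞))).congr' ?_
      refine (eventually_ge_atTop n₀).mono fun n hn => ?_
      have hn' : (n₀ : ℝ) ≤ n := Nat.cast_le.2 hn
      have hE0 : 0 ≤ ‖p.1‖ ^ 2 + ‖p.2‖ ^ 2 := by positivity
      have hle : ‖p.1‖ ^ 2 + ‖p.2‖ ^ 2 ≤ (n : ℝ) ^ 2 := by nlinarith
      simp only [fastMark_eq_zero_of_le hle, ENNReal.ofReal_zero, mul_zero])
  simpa only [lintegral_zero] using h

/-- **Pathwise bookkeeping (the crux functional is charged to the contact pairs).** Along a hard-sphere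
trajectory `γ` (diameter `ε`, `𝕋³`), for a level `K ≥ 0` and windows `(0, t] ⊆ [0, τ]`: the crux's
per-particle throughput summed over the collision times in `(0, t]` is at most the sum over the collision
times in `[0, 0 + τ]` of the fast marks of the ordered contact pairs (the inline double-sum form of
`lintegral_windowCollisionSum_le_of_pairEnvelope`): at a collision time the left limit is `collidePair` of
the colliding pair (`leftLim_eq_collidePair`), only the partners jump (`jumpWeight_collidePair_le`). -/
theorem ofReal_throughput_le_markSum {n : ℕ} {ε : ℝ} {γ : ℝ → Config n (Fin 3) T3}
    (h : IsHardSphereTrajectory (Torus.geometry (Fin 3)) ε n γ) {K : ℝ} (hK : 0 ≤ K) {t τ : ℝ}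
    (htτ : t ≤ τ) :
    ENNReal.ofReal (∑ i : Fin n, ∑ᶠ s ∈ collisionTimes (Torus.geometry (Fin 3)) ε γ ∩ Set.Ioc 0 t,
        (if K < max ‖(Function.leftLim γ s i).2‖ ‖(γ s i).2‖ then
          (1 + ‖(γ s i).2 + (Function.leftLim γ s i).2‖ / 2) * ‖(γ s i).2 - (Function.leftLim γ s i).2‖
          else 0)) ≤
      ∑ᶠ s ∈ collisionTimes (Torus.geometry (Fin 3)) ε γ ∩ Set.Icc 0 (0 + τ),
        ∑ i : Fin n, ∑ j : Fin n,
          (if i ≠ j ∧ ‖(Torus.geometry (Fin 3)).sepVec (γ s i).1 (γ s j).1‖ = ε then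
            ENNReal.ofReal (if K ^ 2 < ‖(γ s i).2‖ ^ 2 + ‖(γ s j).2‖ ^ 2 then 2 * ((1 + ‖(γ s i).2‖ + ‖(γ s j).2‖) * ‖(γ s i).2 - (γ s j).2‖) else 0) else 0) := by
  classical
  set G : Geometry (Fin 3) T3 := Torus.geometry (Fin 3) with hG
  -- the per-time right-hand side
  set R : ℝ → ℝ≥0∞ := fun s => ∑ i : Fin n, ∑ j : Fin n,
    (if i ≠ j ∧ ‖G.sepVec (γ s i).1 (γ s j).1‖ = ε then
      ENNReal.ofReal (if K ^ 2 < ‖(γ s i).2‖ ^ 2 + ‖(γ s j).2‖ ^ 2 then 2 * ((1 + ‖(γ s i).2‖ + ‖(γ s j).2‖) * ‖(γ s i).2 - (γ s j).2‖) else 0) else 0) with hR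
  change _ ≤ ∑ᶠ s ∈ collisionTimes G ε γ ∩ Set.Icc 0 (0 + τ), R s
  have hS' : (collisionTimes G ε γ ∩ Set.Icc 0 (0 + τ)).Finite := h.locFinite 0 (0 + τ)
  have hsub : collisionTimes G ε γ ∩ Set.Ioc 0 t ⊆ collisionTimes G ε γ ∩ Set.Icc 0 (0 + τ) :=
    Set.inter_subset_inter_right _ fun s hs => ⟨hs.1.le, by rw [zero_add]; exact hs.2.trans htτ⟩
  have hS : (collisionTimes G ε γ ∩ Set.Ioc 0 t).Finite := hS'.subset hsub
  -- one collision time: only the colliding pair jumps, and its weights are dominated by the mark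
  have hper : ∀ s ∈ collisionTimes G ε γ,
      ENNReal.ofReal (∑ i : Fin n, (if K < max ‖(Function.leftLim γ s i).2‖ ‖(γ s i).2‖ then (1 + ‖(γ s i).2 + (Function.leftLim γ s i).2‖ / 2) * ‖(γ s i).2 - (Function.leftLim γ s i).2‖ else 0)) ≤ R s := by
    intro s hs
    obtain ⟨p, q, hpq, hc⟩ := mem_collisionTimes.1 hs
    have hL : Function.leftLim γ s = collidePair G p q (γ s) := h.leftLim_eq_collidePair hpq hc
    have hsum : ∑ i : Fin n, (if K < max ‖(Function.leftLim γ s i).2‖ ‖(γ s i).2‖ then (1 + ‖(γ s i).2 + (Function.leftLim γ s i).2‖ / 2) * ‖(γ s i).2 - (Function.leftLim γ s i).2‖ else 0) =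
        (if K < max ‖(collidePair G p q (γ s) p).2‖ ‖(γ s p).2‖ then (1 + ‖(γ s p).2 + (collidePair G p q (γ s) p).2‖ / 2) * ‖(γ s p).2 - (collidePair G p q (γ s) p).2‖ else 0) +
          (if K < max ‖(collidePair G p q (γ s) q).2‖ ‖(γ s q).2‖ then (1 + ‖(γ s q).2 + (collidePair G p q (γ s) q).2‖ / 2) * ‖(γ s q).2 - (collidePair G p q (γ s) q).2‖ else 0) := by
      rw [hL]
      refine Finset.sum_eq_add_of_mem p q (Finset.mem_univ _) (Finset.mem_univ _) hpq ?_
      intro k _ hk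
      rw [collidePair_apply_of_ne hk.1 hk.2]
      simp
    have hcontact : ‖G.sepVec (γ s p).1 (γ s q).1‖ = ε := (mem_contactSet.1 hc).2
    calc ENNReal.ofReal (∑ i : Fin n, (if K < max ‖(Function.leftLim γ s i).2‖ ‖(γ s i).2‖ then (1 + ‖(γ s i).2 + (Function.leftLim γ s i).2‖ / 2) * ‖(γ s i).2 - (Function.leftLim γ s i).2‖ else 0))
        ≤ ENNReal.ofReal (if K ^ 2 < ‖(γ s p).2‖ ^ 2 + ‖(γ s q).2‖ ^ 2 then 2 * ((1 + ‖(γ s p).2‖ + ‖(γ s q).2‖) * ‖(γ s p).2 - (γ s q).2‖) else 0) := by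
          rw [hsum]
          exact ENNReal.ofReal_le_ofReal (jumpWeight_collidePair_le G hpq (γ s) hK)
      _ = (if p ≠ q ∧ ‖G.sepVec (γ s p).1 (γ s q).1‖ = ε then
            ENNReal.ofReal (if K ^ 2 < ‖(γ s p).2‖ ^ 2 + ‖(γ s q).2‖ ^ 2 then 2 * ((1 + ‖(γ s p).2‖ + ‖(γ s q).2‖) * ‖(γ s p).2 - (γ s q).2‖) else 0) else 0) := by
          rw [if_pos (show p ≠ q ∧ ‖G.sepVec (γ s p).1 (γ s q).1‖ = ε from ⟨hpq, hcontact⟩)]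
      _ ≤ ∑ j : Fin n, (if p ≠ j ∧ ‖G.sepVec (γ s p).1 (γ s j).1‖ = ε then
            ENNReal.ofReal (if K ^ 2 < ‖(γ s p).2‖ ^ 2 + ‖(γ s j).2‖ ^ 2 then 2 * ((1 + ‖(γ s p).2‖ + ‖(γ s j).2‖) * ‖(γ s p).2 - (γ s j).2‖) else 0) else 0) :=
          Finset.single_le_sum (f := fun j => (if p ≠ j ∧ ‖G.sepVec (γ s p).1 (γ s j).1‖ = ε then
            ENNReal.ofReal (if K ^ 2 < ‖(γ s p).2‖ ^ 2 + ‖(γ s j).2‖ ^ 2 then 2 * ((1 + ‖(γ s p).2‖ + ‖(γ s j).2‖) * ‖(γ s p).2 - (γ s j).2‖) else 0) else 0)) (fun _ _ => zero_le)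
            (Finset.mem_univ q)
      _ ≤ R s :=
          Finset.single_le_sum (f := fun i => ∑ j : Fin n, (if i ≠ j ∧ ‖G.sepVec (γ s i).1 (γ s j).1‖ = ε
            then ENNReal.ofReal (if K ^ 2 < ‖(γ s i).2‖ ^ 2 + ‖(γ s j).2‖ ^ 2 then 2 * ((1 + ‖(γ s i).2‖ + ‖(γ s j).2‖) * ‖(γ s i).2 - (γ s j).2‖) else 0) else 0)) (fun _ _ => zero_le)
            (Finset.mem_univ p)
  -- honest finite sums, swap, and enlarge the window
  simp_rw [finsum_mem_eq_finite_toFinset_sum _ hS]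
  rw [finsum_mem_eq_finite_toFinset_sum _ hS', Finset.sum_comm,
    ENNReal.ofReal_sum_of_nonneg fun s _ => Finset.sum_nonneg fun i _ => jumpWeight_nonneg _ _ _]
  calc ∑ s ∈ hS.toFinset, ENNReal.ofReal (∑ i : Fin n, (if K < max ‖(Function.leftLim γ s i).2‖ ‖(γ s i).2‖ then (1 + ‖(γ s i).2 + (Function.leftLim γ s i).2‖ / 2) * ‖(γ s i).2 - (Function.leftLim γ s i).2‖ else 0))
      ≤ ∑ s ∈ hS.toFinset, R s :=
        Finset.sum_le_sum fun s hs => hper s ((Set.Finite.mem_toFinset hS).1 hs).1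
    _ ≤ ∑ s ∈ hS'.toFinset, R s :=
        Finset.sum_le_sum_of_subset_of_nonneg (Set.Finite.toFinset_subset_toFinset.2 hsub)
          fun _ _ _ => zero_le


/-- **The normalisation**: `(N+1)^{-4/3} · (x (N+1)² ε_N²) = x σ²` for `ε_N = σ (N+1)^{-1/3}` — the crux's
prefactor times the window-flux constant of `lintegral_windowCollisionSum_le_of_pairEnvelope` is
`N`-independent at fixed reduced density. -/
theorem rpow_mul_windowConst (σ x : ℝ) (N : ℕ) :
    ((N : ℝ) + 1) ^ (-(4 / 3 : ℝ)) * (x * ((N + 1 : ℕ) : ℝ) ^ 2 * hsDiameter σ N ^ 2) = x * σ ^ 2 := by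
  have hm : (0 : ℝ) < (N : ℝ) + 1 := by positivity
  have hcast : ((N + 1 : ℕ) : ℝ) = (N : ℝ) + 1 := by push_cast; ring
  rw [hsDiameter, hcast]
  have key : ((N : ℝ) + 1) ^ (-(4 / 3 : ℝ)) *
      (((N : ℝ) + 1) ^ 2 * (((N : ℝ) + 1) ^ (-(1 / 3 : ℝ))) ^ 2) = 1 := by
    rw [← Real.rpow_natCast ((N : ℝ) + 1) 2, ← Real.rpow_natCast (((N : ℝ) + 1) ^ (-(1 / 3 : ℝ))) 2,
      ← Real.rpow_mul hm.le, ← Real.rpow_add hm, ← Real.rpow_add hm]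
    norm_num
  linear_combination x * σ ^ 2 * key

/-- **Mean form.** For a flow `Φ` of `N + 1` spheres of diameter `ε_N = σ (N+1)^{-1/3}`, a law `P` carried
by the good set whose pair marginals at the times `r ∈ [0, 0 + τ]` are dominated by `C · (Haar ⊗ γ)^{⊗2}`,
a level `K ≥ 0` and `t ≤ τ`, `0 < τ`: the crux's normalised expected fast-collision throughput on `(0, t]`
is at most `4 C τ σ² · ∫ ‖w − v‖ b_K(v, w) dγ dγ` (`ofReal_throughput_le_markSum` and the non-stationary
one-window / Campbell inequality `lintegral_windowCollisionSum_le_of_pairEnvelope`, CIP 1994 App. 4.A). -/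
theorem lintegral_throughput_le_of_pairEnvelope {σ : ℝ} (hσ : 0 < σ) {N : ℕ}
    (Φ : HardSphereFlow (Torus.geometry (Fin 3)) (hsDiameter σ N) (N + 1))
    (P : Measure (Config (N + 1) (Fin 3) T3)) (hP : P Φ.goodᶜ = 0) {t τ : ℝ} (hτ : 0 < τ) (htτ : t ≤ τ)
    {C : ℝ} (hC : 0 ≤ C) (γ : Measure V3) [SFinite γ]
    (henv : ∀ r ∈ Set.Icc (0 : ℝ) (0 + τ), ∀ i j : Fin (N + 1), i ≠ j →
      ∀ f : (T3 × V3) × (T3 × V3) → ℝ≥0∞, Measurable f →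
      ∫⁻ z, f (Φ.flow r z i, Φ.flow r z j) ∂P ≤
        ENNReal.ofReal C * ∫⁻ q, f q ∂(((volume : Measure T3).prod γ).prod ((volume : Measure T3).prod γ)))
    {K : ℝ} (hK : 0 ≤ K) :
    ∫⁻ z, ENNReal.ofReal ((((N : ℝ) + 1) ^ (-(4 / 3 : ℝ))) * ∑ i : Fin (N + 1),
        ∑ᶠ s ∈ collisionTimes (Torus.geometry (Fin 3)) (hsDiameter σ N) (fun s => Φ.flow s z) ∩ Set.Ioc 0 t,
          (if K < max ‖(Function.leftLim (fun s => Φ.flow s z) s i).2‖ ‖(Φ.flow s z i).2‖ then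
            (1 + ‖(Φ.flow s z i).2 + (Function.leftLim (fun s => Φ.flow s z) s i).2‖ / 2) *
              ‖(Φ.flow s z i).2 - (Function.leftLim (fun s => Φ.flow s z) s i).2‖ else 0)) ∂P ≤
      ENNReal.ofReal (4 * C * τ * σ ^ 2) *
        ∫⁻ p, ENNReal.ofReal ‖p.2 - p.1‖ *
          ENNReal.ofReal (if K ^ 2 < ‖p.1‖ ^ 2 + ‖p.2‖ ^ 2 then 2 * ((1 + ‖p.1‖ + ‖p.2‖) * ‖p.1 - p.2‖) else 0) ∂(γ.prod γ) := by
  have hw := CollisionEnergyExchangeMeanBound.lintegral_windowCollisionSum_le_of_pairEnvelope hσ Φ P hP 0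
    hτ hC γ henv (measurable_fastMark K)
  dsimp only at hw
  have hc0 : (0 : ℝ) ≤ ((N : ℝ) + 1) ^ (-(4 / 3 : ℝ)) := Real.rpow_nonneg (by positivity) _
  have hgood : ∀ᵐ z ∂P, z ∈ Φ.good := mem_ae_iff.2 hP
  calc _ ≤ ∫⁻ z, ENNReal.ofReal (((N : ℝ) + 1) ^ (-(4 / 3 : ℝ))) *
        (∑ᶠ s ∈ collisionTimes (Torus.geometry (Fin 3)) (hsDiameter σ N) (fun t => Φ.flow t z) ∩
            Set.Icc 0 (0 + τ),
          ∑ i : Fin (N + 1), ∑ j : Fin (N + 1),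
            (if i ≠ j ∧ ‖(Torus.geometry (Fin 3)).sepVec (Φ.flow s z i).1 (Φ.flow s z j).1‖ = hsDiameter σ N
              then ENNReal.ofReal (if K ^ 2 < ‖(Φ.flow s z i).2‖ ^ 2 + ‖(Φ.flow s z j).2‖ ^ 2 then 2 * ((1 + ‖(Φ.flow s z i).2‖ + ‖(Φ.flow s z j).2‖) * ‖(Φ.flow s z i).2 - (Φ.flow s z j).2‖) else 0) else 0)) ∂P := by
        refine lintegral_mono_ae (hgood.mono fun z hz => ?_)
        rw [ENNReal.ofReal_mul hc0]
        exact mul_le_mul' le_rfl (ofReal_throughput_le_markSum (Φ.isTrajectory z hz) hK htτ)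
    _ = ENNReal.ofReal (((N : ℝ) + 1) ^ (-(4 / 3 : ℝ))) * _ := lintegral_const_mul' _ _ ENNReal.ofReal_ne_top
    _ ≤ ENNReal.ofReal (((N : ℝ) + 1) ^ (-(4 / 3 : ℝ))) *
        (ENNReal.ofReal (4 * C * τ * ((N + 1 : ℕ) : ℝ) ^ 2 * hsDiameter σ N ^ 2) *
          ∫⁻ p, ENNReal.ofReal ‖p.2 - p.1‖ *
            ENNReal.ofReal (if K ^ 2 < ‖p.1‖ ^ 2 + ‖p.2‖ ^ 2 then 2 * ((1 + ‖p.1‖ + ‖p.2‖) * ‖p.1 - p.2‖) else 0) ∂(γ.prod γ)) :=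
        mul_le_mul' le_rfl hw
    _ = ENNReal.ofReal (4 * C * τ * σ ^ 2) *
        ∫⁻ p, ENNReal.ofReal ‖p.2 - p.1‖ *
          ENNReal.ofReal (if K ^ 2 < ‖p.1‖ ^ 2 + ‖p.2‖ ^ 2 then 2 * ((1 + ‖p.1‖ + ‖p.2‖) * ‖p.1 - p.2‖) else 0) ∂(γ.prod γ) := by
        rw [← mul_assoc, ← ENNReal.ofReal_mul hc0, rpow_mul_windowConst]

/-- **The crux at a fixed profile, from a pair envelope of the evolved law.** For profile data
`(a₀, u₀, θ₀)` (any functions) and `σ₀`: IF for all `0 < σ < σ₀`, all flow families and horizons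
`τ > 0` the pair marginals of the evolved local Gibbs law on `[0, τ]` are eventually-in-`N` dominated by
`C · (Haar ⊗ N(u, θ))^{⊗2}` (the pair conjunct of hypothesis (A) of crux `CollisionRate`, stmt-13481), THEN
the body of `FastCollisionThroughput` holds for this profile with threshold `σ₀`: given `t < T` and
`η > 0`, the level `K` is chosen by the vanishing Gaussian fast tail (`tendsto_fastMarkFlux`) against the
`N`-independent constant `4 C (t+1) σ²` of the mean form (window `[0, t + 1]`, so `t = 0` needs no case).
The Euler solution and the initial convergence are not used. -/
theorem fastCollisionThroughputAt_of_pairEnvelope {a₀ θ₀ : T3 → ℝ} {u₀ : T3 → V3} {σ₀ : ℝ}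
    (hA : ∀ σ : ℝ, 0 < σ → σ < σ₀ →
      ∀ Φ : (N : ℕ) → HardSphereFlow (Torus.geometry (Fin 3)) (hsDiameter σ N) (N + 1),
      ∀ τ : ℝ, 0 < τ → ∃ C : ℝ, 0 ≤ C ∧ ∃ u : V3, ∃ θ : ℝ, 0 < θ ∧ ∃ N₀ : ℕ, ∀ N : ℕ, N₀ ≤ N →
      ∀ t ∈ Set.Icc (0 : ℝ) τ,
        ∀ i j : Fin (N + 1), i ≠ j → ∀ f : (T3 × V3) × (T3 × V3) → ℝ≥0∞, Measurable f →
          ∫⁻ z, f ((Φ N).flow t z i, (Φ N).flow t z j) ∂(localGibbsLaw σ a₀ u₀ θ₀ N (Φ N)) ≤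
            ENNReal.ofReal C * ∫⁻ q, f q ∂(((volume : Measure T3).prod (gaussMeasure u θ)).prod
              ((volume : Measure T3).prod (gaussMeasure u θ)))) :
    ∀ σ : ℝ, 0 < σ → σ < σ₀ → ∀ (T : ℝ) (ρ θ : ℝ → T3 → ℝ) (u : ℝ → T3 → V3),
      IsHardSphereEulerSolution σ T ρ u θ →
      ∀ Φ : (N : ℕ) → HardSphereFlow (Torus.geometry (Fin 3)) (hsDiameter σ N) (N + 1),
        TendstoHydroFieldsAt (fun N => localGibbsLaw σ a₀ u₀ θ₀ N (Φ N)) Φ ρ u θ 0 →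
        ∀ t ∈ Set.Ico 0 T, ∀ η : ℝ, 0 < η → ∃ K : ℝ, ∃ N₀ : ℕ, ∀ N : ℕ, N₀ ≤ N →
          ∫⁻ z, ENNReal.ofReal ((((N : ℝ) + 1) ^ (-(4 / 3 : ℝ))) * ∑ i : Fin (N + 1), ∑ᶠ s ∈ Literature.Analysis.FluidPDE.collisionTimes (Literature.Analysis.FluidPDE.Torus.geometry (Fin 3)) (Literature.MathematicalPhysics.KineticTheory.hsDiameter σ N) (fun s => (Φ N).flow s z) ∩ Set.Ioc 0 t, (if K < max ‖(Function.leftLim (fun s => (Φ N).flow s z) s i).2‖ ‖((Φ N).flow s z i).2‖ then (1 + ‖((Φ N).flow s z i).2 + (Function.leftLim (fun s => (Φ N).flow s z) s i).2‖ / 2) * ‖((Φ N).flow s z i).2 - (Function.leftLim (fun s => (Φ N).flow s z) s i).2‖ else 0)) ∂(Literature.MathematicalPhysics.KineticTheory.localGibbsLaw σ a₀ u₀ θ₀ N (Φ N)) ≤ ENNReal.ofReal η := by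
  intro σ hσ hσlt T ρ θ u _hsol Φ _h0 t ht η hη
  have hτ : (0 : ℝ) < t + 1 := by linarith [ht.1]
  obtain ⟨C, hC, u', θ', hθ', N₀, hN⟩ := hA σ hσ hσlt Φ (t + 1) hτ
  -- the level `K`: the Gaussian fast tail of the collision flux is eventually below `η / (4 C (t+1) σ²)`
  have hlim : Tendsto (fun n : ℕ => ENNReal.ofReal (4 * C * (t + 1) * σ ^ 2) *
      ∫⁻ p, ENNReal.ofReal ‖p.2 - p.1‖ *
        ENNReal.ofReal (if (n : ℝ) ^ 2 < ‖p.1‖ ^ 2 + ‖p.2‖ ^ 2 then 2 * ((1 + ‖p.1‖ + ‖p.2‖) * ‖p.1 - p.2‖) else 0)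
          ∂((gaussMeasure u' θ').prod (gaussMeasure u' θ'))) atTop (𝓝 0) := by
    simpa only [mul_zero] using
      ENNReal.Tendsto.const_mul (tendsto_fastMarkFlux u' hθ') (Or.inr ENNReal.ofReal_ne_top)
  obtain ⟨K, hK⟩ := ENNReal.tendsto_atTop_zero.1 hlim (ENNReal.ofReal η) (ENNReal.ofReal_pos.2 hη)
  refine ⟨(K : ℝ), N₀, fun N hNN => ?_⟩
  have hPgood : localGibbsLaw σ a₀ u₀ θ₀ N (Φ N) (Φ N).goodᶜ = 0 := by
    rw [localGibbsLaw_eq]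
    exact localGibbsMeasure_absolutelyContinuous σ _ _ _ N (Φ N) (Φ N).measure_compl_good
  have henv : ∀ r ∈ Set.Icc (0 : ℝ) (0 + (t + 1)), ∀ i j : Fin (N + 1), i ≠ j →
      ∀ f : (T3 × V3) × (T3 × V3) → ℝ≥0∞, Measurable f →
      ∫⁻ z, f ((Φ N).flow r z i, (Φ N).flow r z j) ∂(localGibbsLaw σ a₀ u₀ θ₀ N (Φ N)) ≤
        ENNReal.ofReal C * ∫⁻ q, f q ∂(((volume : Measure T3).prod (gaussMeasure u' θ')).prod
          ((volume : Measure T3).prod (gaussMeasure u' θ'))) :=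
    fun r hr i j hij f hf => hN N hNN r ⟨hr.1, by linarith [hr.2]⟩ i j hij f hf
  exact (lintegral_throughput_le_of_pairEnvelope hσ (Φ N) _ hPgood hτ (by linarith) hC (gaussMeasure u' θ')
    henv (Nat.cast_nonneg K)).trans (hK K le_rfl)

/-- **Wave-2 glue, BY NAME: `FastCollisionThroughput` (stmt-AtomisticToContinuum-13022) FOLLOWS from the crux
item `Theses.BGEndpointRigidity.LanfordEnvelopeR`** (stmt-AtomisticToContinuum-13677: the Lanford/BGSR
Gaussian envelope `|f_N^{(s)}(t)| ≤ C^s e^{-β E_s}` of all volume-marginals of the evolved local Gibbs law on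
`[0, T]`, read on the hard-sphere domain — OPEN at positive times): `LanfordEnvelopeR` ⟹ (A)
(`CollisionRate.stub_marginalEnvelopeLG_of_lanfordEnvelopeR`, pair conjunct) ⟹ the crux
(`fastCollisionThroughputAt_of_pairEnvelope`).  Registered glue stub of stmt-17740. -/
theorem glue_fastCollisionThroughput_of_lanfordEnvelopeR : Summit.AtomisticToContinuum.HydrodynamicLimit.Theses.BGEndpointRigidity.LanfordEnvelopeR → Summit.AtomisticToContinuum.HydrodynamicLimit.Theses.BallwiseInvariantReferences.FastCollisionThroughput := by
  intro hL a₀ θ₀ u₀ ha hθ hu ha0 hθ0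
  obtain ⟨σ₀, hσ₀, hA'⟩ := CollisionRate.stub_marginalEnvelopeLG_of_lanfordEnvelopeR hL a₀ θ₀ u₀ ha hθ hu ha0 hθ0
  refine ⟨σ₀, hσ₀, fastCollisionThroughputAt_of_pairEnvelope fun σ hσ hσlt Φ τ hτ => ?_⟩
  obtain ⟨C, hC, u, θ, hθ', N₀, hN⟩ := hA' σ hσ hσlt Φ τ hτ
  exact ⟨C, hC, u, θ, hθ', N₀, fun N hNN t ht => (hN N hNN t ht).1⟩

end Summit.AtomisticToContinuum.HydrodynamicLimit.Theorems.LTEInBand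

end
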